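import Literature.NumberTheory.EllipticCurves.FormalGroupChartLimitLogBaseChangeProofs
import Mathlib.NumberTheory.Padics.Complex
import HarnessLib

/-!
# The `p`-adic logarithm `log_ω` of a point over a finite (possibly ramified) extension of `ℚ_p`
# — and over any complete valued field: the definitions `limitLog`, `padicLogPointFiniteExt`

Topic `NumberTheory/EllipticCurves`; definition request `defn-padicLogPointFiniteExt`
(cell `bsd-schneider-ideate`, consumer `wi-73260` = Castella–Hsieh, *Heegner cycles and `p`-adic
`L`-functions*, Math. Ann. 370 (2018), Lemma 5.4 and Thm. 5.7: the value of the BDP branch at a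
conductor-`pⁿ` character is an explicit unit times the SQUARE of `log_{ω_E}` of a Heegner point
of conductor `pⁿ`, the logarithm being taken in the completion of the ring class field `K[pⁿ]` at
a prime above `𝔭` — a RAMIFIED extension of `ℚ_p` for `n ≥ 1`; shared with cell `bsd-addord`,
crux `KatoKuriharaPortThreeShared`, clause SAT₀, where the same logarithm is needed over the
unramified layers `ℚ₃(ζ_m)`).

## What the tree had, and what this file adds

The tree's logarithm layer with DEFINITIONS is `ℚ_p`-only: the power series `log_W = ∫ω`
evaluated `p`-adically (`WeierstrassCurve.padicLogPoint`, file `FormalGroup`), the limit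
`L(P) = lim z(pᵏP)/pᵏ` (`WeierstrassCurve.padicLimitLog`, file `PadicPointsFiltration`) and, on
the Summits side, `X11b.Halves.logOmega` / `Additive.LocalLog.padicLog` (`= log_W(z(m•P))/m`).
Over an ARBITRARY valued field `(K, w)` the tree has the power-series-free chart calculus
(`FormalGroupChart`: `z = -x/y`, the kernel of reduction `E₁ = kernel w V`, the levels
`E⁽ᵗ⁾ = level w V t`) and — files `FormalGroupChartLimitLog{Proofs, EquivarianceProofs,
AdditiveProofs, BaseChangeProofs}` — the complete theory of the **limit logarithm on the level
`E⁽ᵖ⁾ = {P ∈ E₁ : |z(P)| ≤ |p|}`**, deliberately WITHOUT a definition: existence (under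
completeness) of a function `ℓ` with the approximation property

  (SPEC) `∀ Q ∈ E⁽ᵖ⁾, ∀ r, |ℓ(Q) − z(pʳ·Q)/pʳ| ≤ |p|^{r+1}`,

and, for ANY `ℓ` with (SPEC): uniqueness, `𝒪`-integrality, additivity, no kernel strictly inside
the level, Galois equivariance, base change along isometric embeddings, and over `ℚ_p` the
identification `ℓ(Q) = padicLimitLog(p•Q)/p` on all of `E₁(ℚ_p)`.

This file supplies the two review-lane DEFINITIONS on top of that theory and their API:

* `FormalGroupChart.limitLog w V p Q` — **the limit logarithm** `ℓ_p(Q) = lim_r z(pʳ·Q)/pʳ`: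
  the (unique, `limitLog_unique`) value `y` with `|y − z(pʳ·Q)/pʳ| ≤ |p|^{r+1}` for all `r`, junk
  `0` when there is none.  `limitLog_spec` / `limitLog_spec_of_completeSpace`: under completeness it
  HAS (SPEC) on `E⁽ᵖ⁾`, so every theorem of the four `LimitLog` files applies to it verbatim
  (pass `hℓ := limitLog_spec_of_completeSpace hp0 hp1`); `eq_limitLog_of_spec`: every (SPEC)
  function IS `limitLog` on the level; `tendsto_limitLog`: it is the limit of `z(pʳ·Q)/pʳ`.
* `FormalGroupChart.padicLogPointFiniteExt w V p P` — **the logarithm of an arbitrary point**: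
  `ℓ_p(m₀ • P)/m₀` for the least `m₀ ≥ 1` with `m₀ • P ∈ E⁽ᵖ⁾` (junk `0` if no multiple of `P`
  lies in the level).  This is the classical `log_ω(P) := log_Ê([m]P)/m` (Silverman, *AEC*
  IV.6, VII.2.2; as used by Castella–Hsieh, Kato, Mazur–Tate–Teitelbaum §II, Mazur–Stein–Tate §3,
  and by the tree's `logOmega`), `ω` the invariant differential of the MODEL `V`
  (`ω = dx/(2y + a₁x + a₃)`; for the Néron differential take `V` a minimal model).
  API (hypotheses: `0 < |p| < 1` and (SPEC) for `limitLog`, i.e. completeness):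
  - `padicLogPointFiniteExt_eq_div` — **independence of `m`**: `= ℓ_p(m • P)/m` for EVERY
    `m ≥ 1` with `m • P ∈ E⁽ᵖ⁾`; `padicLogPointFiniteExt_eq_limitLog` — `= ℓ_p` on `E⁽ᵖ⁾`;
  - `padicLogPointFiniteExt_zero/_add/_neg/_nsmul` — a homomorphism on the subgroup of points
    having a multiple in the level (pattern of the named fact `padicLogPoint_add`);
  - `padicLogPointFiniteExt_eq_zero_iff` — **`log P = 0 ↔ P` is torsion** (pattern of
    `X11b.R1.logOmega_eq_zero_iff`);
  - `padicLogPointFiniteExt_map` — **Galois equivariance** `log(σ P) = σ(log P)` for an isometric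
    `E`-algebra automorphism `σ` of `L ⊇ E`; `padicLogPointFiniteExt_map_of_val_eq` —
    **functoriality in the field** `log_{K'}(ι P) = ι(log_K P)` along an isometric `E`-algebra map
    `ι : K → K'` (e.g. `F ⊆ F'`, or `F ↪ ℂ_p`: the `ℂ_p`-valued version is the instance
    `K := ℂ_[p]`, section `PadicComplex`: `limitLog_spec_padicComplex`,
    `padicLogPointFiniteExt_{eq_div,add,eq_zero_iff}_padicComplex`, `exists_nsmul_mem_level_padicComplex`);
  - `padicLogPointFiniteExt_eq_padicLimitLog_div` — **agreement over `ℚ_p`**: for a `p`-integral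
    elliptic `X/ℚ_p` and `m • P ∈ E₁(ℚ_p)`, `log P = padicLimitLog(p • m • P)/(p·m)`; the
    Summits-side one-liners `Additive.LocalLog.padicLog_eq_padicLogPoint_nsmul_div` /
    `X11b.R1.logOmega_eq_padicLog` / `KimAtThreeFineKatoLimitLogPadic.padicLog_eq_limitLog` then
    identify it with `padicLog`, `log_W ∘ z` and `logOmega` there (Literature cannot import them).
* **Domain lemmas** (when is the value NOT junk): `exists_pow_smul_mem_level_of_mem_kernel` —
  every point of `E₁(K)` has a `p`-power multiple in `E⁽ᵖ⁾` (any valued field: the chart estimate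
  `|z(p•Q)| ≤ max(|p||z(Q)|, |z(Q)|²)` iterated), and
  `exists_nsmul_mem_kernel_of_finite_residueField` / `exists_nsmul_mem_level_of_finite_residueField`
  — over a valued field with FINITE residue field every point of `E₀(K)` (nonsingular reduction;
  all of `E(K)` under good reduction, `GeomPointReduction.hasNonsingularReduction_of_isUnit_Δ`) has
  a multiple in `E₁(K)`, hence in `E⁽ᵖ⁾` (the reduction homomorphism `E₀(K) → Ẽ_ns(k)` of
  `ReductionHomomorphism` has kernel `E₁(K)` and finite target).  So for a finite extension
  `F/ℚ_p` and good reduction `padicLogPointFiniteExt` is the genuine `log_ω` on all of `E(F)`.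
* Plumbing: `isIntegral_integer_baseChange`, `isIntegral_valuation_baseChange_int` (integral
  models give the `IsIntegral` hypothesis in the normed currency); private: `0 < |p| < 1` forces
  characteristic `0` (`charZero_of_val_natCast_lt_one`), the constants `0 < ‖p‖ < 1` of `ℚ_p`, `ℂ_p`.

Everything is proved; no named facts; no instances, no notation.

## Sources

* [SilvermanAEC2009] J. H. Silverman, *The Arithmetic of Elliptic Curves*, 2nd ed., GTM 106
  (2009): IV.3 Prop. 3.2 (the filtration `Ê(𝓜ⁿ)`), IV.5–IV.6 (the formal logarithm;
  Thm. IV.6.4: `log_Ê : Ê(𝓜ʳ) ≅ 𝓜ʳ` for `r > v(p)/(p−1)`, torsion-freeness Prop. IV.3.2(b)),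
  VII.2 Props. 2.1–2.2 (`E₀ → Ẽ_ns(k)` with kernel `E₁`, `E₁(K) ≅ Ê(𝓜)`), VII.3 Prop. 3.1.
* [MazurTateTeitelbaum1986] B. Mazur, J. Tate, J. Teitelbaum, Invent. Math. 84 (1986), §II
  (the extension `log(P) = log([m]P)/m` to all of `E(K)`).
* F. Castella, M.-L. Hsieh, *Heegner cycles and `p`-adic `L`-functions*, Math. Ann. 370 (2018),
  §5 (Lemma 5.4, Thm. 5.7: `log_{ω_E}` over the ramified completions of `K[pⁿ]`) — consumer only.

## Design

`noncomputable section`, `open scoped Classical NNReal`; namespace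
`Literature.NumberTheory.EllipticCurves.FormalGroupChart` (the vocabulary `kernel`, `level`,
`Affine.Point.zCoord` of the chart files).  The general layer is stated for a valued field
`(K, w : Valuation K ℝ≥0)` exactly as the `LimitLog` files (the (SPEC) hypothesis on `limitLog`
spelled out as `hℓ`, discharged by `limitLog_spec[_of_completeSpace]`); section `Normed` gives the
hypothesis-free corollaries for complete nonarchimedean normed fields
(`[NontriviallyNormedField K] [IsUltrametricDist K] [CompleteSpace K]`, `w = NormedField.valuation`),
which is the currency of `ℚ_[p]`, `ℂ_[p]`, `v.adicCompletion K` and finite extensions of `ℚ_p`.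
Equivariance / base change use one universe for `E`, `K`, `K'` as the layer files do.
-/

noncomputable section

open scoped Classical NNReal

namespace Literature.NumberTheory.EllipticCurves.FormalGroupChart

/-! ### The definitions -/

section Defs

variable {K : Type*} [Field K] (w : Valuation K ℝ≥0) (V : WeierstrassCurve K) (p : ℕ)

/-- **The limit logarithm `ℓ_p(Q) = lim_r z(pʳ·Q)/pʳ`** of a point of a Weierstrass equation over
a valued field `(K, w)`, for a natural number `p` (in the applications the residue characteristic,
`0 < |p| < 1`): the value `y ∈ K` with `|y − z(pʳ·Q)/pʳ| ≤ |p|^{r+1}` for every `r` — unique when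
`|p| < 1` (`limitLog_unique`), and existing for every `Q` of the level `E⁽ᵖ⁾ = {P ∈ E₁ : |z(P)| ≤ |p|}`
when `K` is complete (`exists_limitLog`, `exists_limitLog_of_completeSpace`) — and the junk value
`0` when there is no such `y`.  On `E⁽ᵖ⁾` this is the formal-group logarithm `log_Ê(z(Q))` of
Silverman, *AEC* IV.5–IV.6 read on points through `z = -x/y` (Prop. VII.2.2), obtained without
power series as the limit of `[pʳ](z)/pʳ`; all theorems of the files
`FormalGroupChartLimitLog*` (stated for any function with the approximation property (SPEC)) apply
to it through `limitLog_spec` / `limitLog_spec_of_completeSpace`.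
[cite: SilvermanAEC2009, Thm. IV.6.4 with Prop. VII.2.2] -/
def limitLog (Q : V.toAffine.Point) : K :=
  if h : ∃ y : K, ∀ r : ℕ, w (y - ((p ^ r) • Q).zCoord / (p : K) ^ r) ≤ w (p : K) ^ (r + 1)
  then Classical.choose h else 0

variable [hV : V.IsIntegral w.integer]

/-- **The `p`-adic logarithm `log_ω(P)` of an ARBITRARY point** of a `w`-integral Weierstrass
equation `V` over a valued field `(K, w)` — in the applications `K` a finite, possibly ramified,
extension of `ℚ_p` (or `ℂ_p`, or a completion `K_v` of a number field) with `w = ‖·‖₊`: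
`log_ω(P) := ℓ_p(m₀ • P)/m₀` where `ℓ_p = limitLog w V p` is the logarithm on the level
`E⁽ᵖ⁾ = {Q ∈ E₁(K) : |z(Q)| ≤ |p|}` and `m₀` is the least `m ≥ 1` with `m • P ∈ E⁽ᵖ⁾`; junk
value `0` when no positive multiple of `P` lies in `E⁽ᵖ⁾` (never the case over a finite extension
of `ℚ_p` for points of nonsingular reduction: `exists_nsmul_mem_level_of_finite_residueField`).
The value does not depend on the choice of `m` (`padicLogPointFiniteExt_eq_div`: `= ℓ_p(m • P)/m`
for every admissible `m`, e.g. `m = #Ẽ_ns(k)·[E(K):E₀(K)]·pᵃ`).  This is the classical extension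
of the formal-group logarithm `log_Ê ∘ z : E₁(K) → K` to `E(K) ⊗ ℚ` (Silverman, *AEC* IV.6,
VII.2.2; Mazur–Tate–Teitelbaum §II), `ω = dx/(2y + a₁x + a₃)` the invariant differential of the
model `V` (the Néron differential when `V` is minimal); the tree's `WeierstrassCurve.padicLogPoint`
/ `X11b.Halves.logOmega` are the case `K = ℚ_p` (`padicLogPointFiniteExt_eq_padicLimitLog_div`).
[cite: SilvermanAEC2009, Thm. IV.6.4 with Prop. VII.2.2] [cite: MazurTateTeitelbaum1986, §II] -/
def padicLogPointFiniteExt (P : V.toAffine.Point) : K :=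
  if h : ∃ m : ℕ, 0 < m ∧ m • P ∈ level w V (w (p : K))
  then limitLog w V p (Nat.find h • P) / (Nat.find h : K) else 0

end Defs

/-! ### Plumbing: `0 < |p| < 1` forces characteristic zero; integral models -/

section Plumbing

variable {K : Type*} [Field K] (w : Valuation K ℝ≥0)

/-- `|a| ≤ 1` for every integer `a` (valuations are bounded by `1` on the prime ring). [folklore] -/
private theorem val_intCast_le_one (a : ℤ) : w (a : K) ≤ 1 := by
  obtain ⟨n, rfl | rfl⟩ := Int.eq_nat_or_neg a
  · rw [Int.cast_natCast]; exact val_natCast_le_one w n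
  · rw [Int.cast_neg, Int.cast_natCast, Valuation.map_neg]; exact val_natCast_le_one w n

variable {w} in
/-- **A valued field containing a natural number `p` with `0 < |p| < 1` has characteristic `0`**:
in characteristic `q > 0` either `q ∣ p` (then `p = 0` in `K`) or `p` is a unit modulo `q`, i.e.
`a·p = 1 − b·q = 1` in `K` with `|a| ≤ 1`, forcing `|p| ≥ 1`. [folklore] -/
private theorem charZero_of_val_natCast_lt_one {p : ℕ} (hp0 : (p : K) ≠ 0) (hp1 : w (p : K) < 1) :
    CharZero K := by
  rcases CharP.char_is_prime_or_zero K (ringChar K) with hq | hq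
  · exfalso
    have hqp : ¬ ringChar K ∣ p := fun h ↦ hp0 ((ringChar.spec K p).mpr h)
    have hcop : Nat.Coprime (ringChar K) p := (Nat.Prime.coprime_iff_not_dvd hq).mpr hqp
    have e : ((Nat.gcd (ringChar K) p : ℕ) : ℤ) =
        (ringChar K : ℤ) * Nat.gcdA (ringChar K) p + (p : ℤ) * Nat.gcdB (ringChar K) p :=
      Nat.gcd_eq_gcd_ab (ringChar K) p
    rw [Nat.Coprime.gcd_eq_one hcop] at e
    have eK : (1 : K) = (ringChar K : K) * (Nat.gcdA (ringChar K) p : K) +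
        (p : K) * (Nat.gcdB (ringChar K) p : K) := by
      have h := congrArg (Int.cast : ℤ → K) e
      push_cast at h
      exact h
    rw [ringChar.Nat.cast_ringChar, zero_mul, zero_add] at eK
    have h1 : (1 : ℝ≥0) ≤ w (p : K) * w (Nat.gcdB (ringChar K) p : K) := by
      rw [← map_mul, ← eK, map_one]
    have h2 : w (p : K) * w (Nat.gcdB (ringChar K) p : K) < 1 :=
      calc w (p : K) * w (Nat.gcdB (ringChar K) p : K) ≤ w (p : K) * 1 :=
            mul_le_mul' le_rfl (val_intCast_le_one w _)
        _ = w (p : K) := mul_one _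
        _ < 1 := hp1
    exact lt_irrefl _ (h1.trans_lt h2)
  · haveI : CharP K 0 := ringChar.of_eq hq
    exact CharP.charP_to_charZero K

/-- A Weierstrass equation with coefficients in the valuation ring `𝒪 = w.integer`, base-changed
to `K`, is `w`-integral (the hypothesis `IsIntegral w.integer` of the chart files; Silverman's
"Weierstrass equation with coefficients in `R = {x ∈ K : v(x) ≥ 0}`").
[cite: SilvermanAEC2009, VII.1 (Weierstrass equations with coefficients in R, PDF p. 165)] -/
theorem isIntegral_integer_baseChange (W₀ : WeierstrassCurve w.integer) :
    (W₀.baseChange K).IsIntegral w.integer :=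
  ⟨⟨W₀, rfl⟩⟩

/-- **Integer models are integral in the normed currency**: for a Weierstrass equation `W₀` with
coefficients in `ℤ` and a nonarchimedean normed field `K` (so `‖n‖ ≤ 1` for every integer `n`;
any `ℤ`-algebra structure, e.g. the completion's own on `ℂ_[p]`), `W₀ ⊗ K` is integral for the valuation ring `{‖x‖ ≤ 1}` of `NormedField.valuation = ‖·‖₊` — the
hypothesis under which `limitLog` / `padicLogPointFiniteExt` over `K = ℚ_p`, `ℂ_p`, `K_v`, a
finite extension of `ℚ_p`, … have their meaning.
[cite: SilvermanAEC2009, VII.1 (Weierstrass equations with coefficients in R, PDF p. 165)] -/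
theorem isIntegral_valuation_baseChange_int {K : Type*} [NormedField K] [IsUltrametricDist K]
    [Algebra ℤ K] (W₀ : WeierstrassCurve ℤ) :
    (W₀.baseChange K).IsIntegral (NormedField.valuation (K := K)).integer := by
  have hmem : ∀ a : ℤ, algebraMap ℤ K a ∈ (NormedField.valuation (K := K)).integer := fun a ↦ by
    change NormedField.valuation (algebraMap ℤ K a) ≤ 1
    rw [eq_intCast, NormedField.valuation_apply, ← NNReal.coe_le_coe, coe_nnnorm, NNReal.coe_one]
    exact IsUltrametricDist.norm_intCast_le_one K a
  exact WeierstrassCurve.isIntegral_of_exists_lift _ ⟨⟨_, hmem W₀.a₁⟩, rfl⟩ ⟨⟨_, hmem W₀.a₂⟩, rfl⟩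
    ⟨⟨_, hmem W₀.a₃⟩, rfl⟩ ⟨⟨_, hmem W₀.a₄⟩, rfl⟩ ⟨⟨_, hmem W₀.a₆⟩, rfl⟩

end Plumbing

/-! ### `limitLog` has (SPEC): every theorem of the `LimitLog` files applies to it -/

section LimitLogSpec

variable {K : Type*} [Field K] {w : Valuation K ℝ≥0} {V : WeierstrassCurve K} {p : ℕ}

/-- Pointwise form of the definition: if SOME `y` approximates `z(pʳ·Q)/pʳ` to within `|p|^{r+1}`
for all `r`, then `limitLog w V p Q` does. [cite: SilvermanAEC2009, Thm. IV.6.4] -/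
theorem limitLog_spec_of_exists {Q : V.toAffine.Point}
    (h : ∃ y : K, ∀ r : ℕ, w (y - ((p ^ r) • Q).zCoord / (p : K) ^ r) ≤ w (p : K) ^ (r + 1))
    (r : ℕ) : w (limitLog w V p Q - ((p ^ r) • Q).zCoord / (p : K) ^ r) ≤ w (p : K) ^ (r + 1) := by
  rw [limitLog, dif_pos h]
  exact Classical.choose_spec h r

/-- Off its domain of convergence `limitLog` is the junk value `0` (definition unfolding; the
logarithm of Silverman *AEC* IV.6.4 is only defined where the limit exists).
[cite: SilvermanAEC2009, Thm. IV.6.4 with Prop. VII.2.2] -/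
theorem limitLog_of_not_exists {Q : V.toAffine.Point}
    (h : ¬ ∃ y : K, ∀ r : ℕ, w (y - ((p ^ r) • Q).zCoord / (p : K) ^ r) ≤ w (p : K) ^ (r + 1)) :
    limitLog w V p Q = 0 := by
  rw [limitLog, dif_neg h]

variable [hV : V.IsIntegral w.integer]

/-- **`limitLog` has (SPEC) on the level `E⁽ᵖ⁾` under completeness** (`hcomplete` in the shape of
the layer files, as in `exists_limitLog`): `|ℓ_p(Q) − z(pʳ·Q)/pʳ| ≤ |p|^{r+1}` for every
`Q ∈ E⁽ᵖ⁾` and every `r`.  Feed this as the hypothesis `hℓ` of `limitLog_add`, `limitLog_unique`,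
`val_limitLog_le_val_natCast`, `limitLog_map`, … . [cite: SilvermanAEC2009, Thm. IV.6.4 with Prop. VII.2.2] -/
theorem limitLog_spec (hp0 : (p : K) ≠ 0)
    (hcomplete : ∀ x : ℕ → K, (∀ r, w (x (r + 1) - x r) ≤ w (p : K) ^ (r + 1)) →
      ∃ y : K, ∀ r, w (y - x r) ≤ w (p : K) ^ (r + 1)) :
    ∀ Q ∈ level w V (w (p : K)), ∀ r : ℕ,
      w (limitLog w V p Q - ((p ^ r) • Q).zCoord / (p : K) ^ r) ≤ w (p : K) ^ (r + 1) :=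
  fun _ hQ r ↦ limitLog_spec_of_exists (exists_forall_val_sub_approx_le hp0 hcomplete hQ.1 hQ.2) r

omit hV in
/-- **Every function with (SPEC) IS `limitLog` on the level** (uniqueness of `|p|`-adic limits,
`limitLog_unique`): in particular the `ℓ` of `exists_limitLog` / `exists_limitLog_of_completeSpace`
/ `exists_limitLog_padic`, and — through `spec_of_additive_of_val_sub_zCoord_le` — any additive
function with the quadratic estimate. [cite: SilvermanAEC2009, Thm. IV.6.4] -/
theorem eq_limitLog_of_spec [V.IsIntegral w.integer] (hp1 : w (p : K) < 1)
    {ℓ : V.toAffine.Point → K}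
    (hℓ : ∀ Q ∈ level w V (w (p : K)), ∀ r : ℕ,
      w (ℓ Q - ((p ^ r) • Q).zCoord / (p : K) ^ r) ≤ w (p : K) ^ (r + 1))
    {Q : V.toAffine.Point} (hQ : Q ∈ level w V (w (p : K))) : ℓ Q = limitLog w V p Q :=
  limitLog_eq_of_forall_val_sub_approx_le hp1 hℓ hQ
    (fun r ↦ limitLog_spec_of_exists ⟨ℓ Q, hℓ Q hQ⟩ r)

end LimitLogSpec

/-! ### Domain lemmas: which points have a multiple in the level `E⁽ᵖ⁾` -/

section Domain

variable {K : Type*} [Field K] {w : Valuation K ℝ≥0} {V : WeierstrassCurve K}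
  [hV : V.IsIntegral w.integer] {p : ℕ}

/-- **Every point of `E₁(K)` has a `p`-power multiple in the level `E⁽ᵖ⁾`** (any valued field,
`0 < |p|`): from `|z(p•Q) − p·z(Q)| ≤ |z(Q)|²` one gets `|z(p•Q)| ≤ max(|p|·|z(Q)|, |z(Q)|²)`, so
along `Q, p•Q, p²•Q, …` either the level is reached or `|z| ≤ ρ^{2ʳ}` with `ρ = |z(P)| < 1`,
which drops below `|p|`.  (Silverman, *AEC* IV.3.2 / IV.6: `[p]` maps `Ê(𝓜ⁿ)` into `Ê(𝓜ⁿ⁺¹)`;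
over a finite extension of `ℚ_p` this is the finiteness of `E₁/E⁽ᵖ⁾`, of `p`-power order.)
[cite: SilvermanAEC2009, Prop. IV.3.2 and Prop. IV.2.3 with Prop. VII.2.2] -/
theorem exists_pow_smul_mem_level_of_mem_kernel (hp0 : (p : K) ≠ 0) {P : V.toAffine.Point}
    (hP : P ∈ kernel w V) : ∃ r : ℕ, (p ^ r) • P ∈ level w V (w (p : K)) := by
  have hp : 0 < w (p : K) := (Valuation.pos_iff w).mpr hp0
  have hρ1 : w P.zCoord < 1 := val_zCoord_lt_one hP
  have key : ∀ r : ℕ, (p ^ r) • P ∈ level w V (w (p : K)) ∨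
      w ((p ^ r) • P).zCoord ≤ w P.zCoord ^ (2 ^ r) := by
    intro r
    induction r with
    | zero => exact Or.inr (by rw [pow_zero, one_nsmul, pow_zero, pow_one])
    | succ r ih =>
      have e : (p ^ (r + 1)) • P = p • (p ^ r) • P := by rw [pow_succ', mul_nsmul']
      rcases ih with h | h
      · exact Or.inl (by rw [e]; exact (level w V (w (p : K))).nsmul_mem h p)
      · by_cases hs : w ((p ^ r) • P).zCoord ≤ w (p : K)
        · exact Or.inl (by
            rw [e]
            exact (level w V (w (p : K))).nsmul_mem ⟨(kernel w V).nsmul_mem hP _, hs⟩ p)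
        · right
          have hlt : w (p : K) < w ((p ^ r) • P).zCoord := lt_of_not_ge hs
          have hK : (p ^ r) • P ∈ kernel w V := (kernel w V).nsmul_mem hP _
          have h1 := val_zCoord_nsmul_sub_le hK p
          have h2 : w ((p : K) * ((p ^ r) • P).zCoord) ≤ w ((p ^ r) • P).zCoord ^ 2 := by
            rw [map_mul, pow_two]
            exact mul_le_mul' hlt.le le_rfl
          have e2 : (p • (p ^ r) • P).zCoord =
              ((p • (p ^ r) • P).zCoord - p * ((p ^ r) • P).zCoord) +
                p * ((p ^ r) • P).zCoord := by ring
          rw [e, e2]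
          refine ((w.map_add _ _).trans (max_le h1 h2)).trans ?_
          calc w ((p ^ r) • P).zCoord ^ 2 ≤ (w P.zCoord ^ (2 ^ r)) ^ 2 := by gcongr
            _ = w P.zCoord ^ (2 ^ (r + 1)) := by rw [← pow_mul, pow_succ]
  obtain ⟨n, hn⟩ := exists_pow_lt_of_lt_one hp hρ1
  rcases key n with h | h
  · exact ⟨n, h⟩
  · refine ⟨n, (kernel w V).nsmul_mem hP _, h.trans ?_⟩
    exact (pow_le_pow_right_of_le_one' hρ1.le (Nat.lt_two_pow_self).le).trans hn.le

/-- Hence **every point of `E₁(K)` has a positive multiple in `E⁽ᵖ⁾`**.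
[cite: SilvermanAEC2009, Prop. IV.3.2 with Prop. VII.2.2] -/
theorem exists_nsmul_mem_level_of_mem_kernel (hp0 : (p : K) ≠ 0) {P : V.toAffine.Point}
    (hP : P ∈ kernel w V) : ∃ m : ℕ, 0 < m ∧ m • P ∈ level w V (w (p : K)) := by
  obtain ⟨r, hr⟩ := exists_pow_smul_mem_level_of_mem_kernel hp0 hP
  have hpn : p ≠ 0 := by rintro rfl; exact hp0 Nat.cast_zero
  exact ⟨p ^ r, pow_pos (Nat.pos_of_ne_zero hpn) r, hr⟩

end Domain

section Reduction

universe u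

variable {L : Type u} [Field L] {w : Valuation L ℝ≥0} (W₀ : WeierstrassCurve w.integer)
  [hV : (W₀.baseChange L).IsIntegral w.integer]

/-- `E₁` in the two renderings of the tree: a point of `W₀ ⊗ L` lies in
`FormalGroupChart.kernel w (W₀ ⊗ L)` iff it `ReducesToZero` in the sense of
`ReductionHomomorphism` (`O` or `x ∉ 𝒪`): Silverman's kernel of reduction `E₁(K)`.  (Private
copy of `GoodReductionLangLift`'s `mem_kernel_iff_reducesToZero`, whose imports are heavy.)
[cite: SilvermanAEC2009, VII.2 (definition of E₁(K), PDF p. 167)] -/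
private theorem mem_kernel_iff_reducesToZero_aux (P : (W₀.baseChange L).toAffine.Point) :
    P ∈ kernel w (W₀.baseChange L) ↔ W₀.ReducesToZero P := by
  rcases P with _ | ⟨x, y, h⟩
  · exact ⟨fun _ ↦ trivial, fun _ ↦ (kernel w (W₀.baseChange L)).zero_mem⟩
  · rw [some_mem_kernel_iff, WeierstrassCurve.reducesToZero_some_iff,
      not_mem_range_iff (Valuation.integer.integers w)]

/-- Over a finite field a Weierstrass cubic has finitely many points (they inject into
`Option (k × k)`). [folklore] -/
private theorem finite_point_of_finite {k : Type*} [Field k] [Finite k] (W : WeierstrassCurve k) :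
    Finite W.toAffine.Point := by
  refine Finite.of_injective (fun P : W.toAffine.Point ↦ match P with
    | .zero => (none : Option (k × k))
    | .some x y _ => some (x, y)) ?_
  rintro (_ | ⟨x, y, h⟩) (_ | ⟨x', y', h'⟩) hPQ
  · rfl
  · exact (Option.some_ne_none _ hPQ.symm).elim
  · exact (Option.some_ne_none _ hPQ).elim
  · simp only [Option.some.injEq, Prod.mk.injEq] at hPQ
    obtain ⟨rfl, rfl⟩ := hPQ
    rfl

/-- **Finite residue field: every point of `E₀(L)` has a positive multiple in `E₁(L)`.**  The
reduction homomorphism `E₀(L) → Ẽ_ns(k)` (`WeierstrassCurve.reductionHom`, Silverman *AEC*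
Prop. VII.2.1) has kernel `E₁(L)` (`reductionHom_ker`) and FINITE target when the residue field
`k = 𝒪/𝔪` is finite, so `m • P ∈ E₁(L)` for `m` the order of `P̃`.  (Under good reduction
`E₀ = E`, `GeomPointReduction.hasNonsingularReduction_of_isUnit_Δ`; in general `[E(L):E₀(L)]` is
the Tamagawa number.) [cite: SilvermanAEC2009, VII.2 Prop. 2.1 (PDF p. 167)] -/
theorem exists_nsmul_mem_kernel_of_finite_residueField
    [Finite (IsLocalRing.ResidueField w.integer)] {P : (W₀.baseChange L).toAffine.Point}
    (hP : P ∈ W₀.nonsingularReductionSubgroup (Valuation.integer.integers w)) :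
    ∃ m : ℕ, 0 < m ∧ m • P ∈ kernel w (W₀.baseChange L) := by
  haveI := finite_point_of_finite (W₀.map (IsLocalRing.residue w.integer))
  let P₀ : W₀.nonsingularReductionSubgroup (Valuation.integer.integers w) := ⟨P, hP⟩
  have hfin : IsOfFinAddOrder (W₀.reductionHom (Valuation.integer.integers w) P₀) :=
    isOfFinAddOrder_of_finite _
  refine ⟨addOrderOf (W₀.reductionHom (Valuation.integer.integers w) P₀), hfin.addOrderOf_pos, ?_⟩
  have hker : addOrderOf (W₀.reductionHom (Valuation.integer.integers w) P₀) • P₀ ∈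
      (W₀.reductionHom (Valuation.integer.integers w)).ker := by
    rw [AddMonoidHom.mem_ker, map_nsmul, addOrderOf_nsmul_eq_zero]
  rw [WeierstrassCurve.reductionHom_ker, AddSubgroup.mem_addSubgroupOf,
    WeierstrassCurve.mem_kernelOfReduction_iff, AddSubgroup.coe_nsmul] at hker
  rw [mem_kernel_iff_reducesToZero_aux]
  exact hker

/-- **Finite residue field: every point of `E₀(L)` has a positive multiple in the level `E⁽ᵖ⁾`**
(`0 < |p|`), so `padicLogPointFiniteExt` takes its genuine (non-junk) value on all of `E₀(L)` —
on all of `E(L)` under good reduction.  This is the situation of a finite extension `L/ℚ_p`.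
[cite: SilvermanAEC2009, VII.2 Prop. 2.1 and Prop. IV.3.2] -/
theorem exists_nsmul_mem_level_of_finite_residueField
    [Finite (IsLocalRing.ResidueField w.integer)] {p : ℕ} (hp0 : (p : L) ≠ 0)
    {P : (W₀.baseChange L).toAffine.Point}
    (hP : P ∈ W₀.nonsingularReductionSubgroup (Valuation.integer.integers w)) :
    ∃ m : ℕ, 0 < m ∧ m • P ∈ level w (W₀.baseChange L) (w (p : L)) := by
  obtain ⟨m, hm, hmP⟩ := exists_nsmul_mem_kernel_of_finite_residueField W₀ hP
  obtain ⟨n, hn, hnP⟩ := exists_nsmul_mem_level_of_mem_kernel hp0 hmP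
  refine ⟨n * m, Nat.mul_pos hn hm, ?_⟩
  rw [mul_nsmul']
  exact hnP

end Reduction

/-! ### The logarithm of an arbitrary point: independence of `m`, additivity, torsion kernel -/

section Ext

variable {K : Type*} [Field K] {w : Valuation K ℝ≥0} {V : WeierstrassCurve K}
  [hV : V.IsIntegral w.integer] {p : ℕ}

/-- Junk: a point with no positive multiple in the level has `log = 0` (definition unfolding; the
extension `log([m]P)/m` of Mazur–Tate–Teitelbaum §II is only defined where such an `m` exists).
[cite: MazurTateTeitelbaum1986, §II] -/
theorem padicLogPointFiniteExt_of_not_exists {P : V.toAffine.Point}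
    (h : ¬ ∃ m : ℕ, 0 < m ∧ m • P ∈ level w V (w (p : K))) :
    padicLogPointFiniteExt w V p P = 0 := by
  rw [padicLogPointFiniteExt, dif_neg h]

/-- **Independence of `m`: `log_ω(P) = ℓ_p(m • P)/m` for EVERY `m ≥ 1` with `m • P ∈ E⁽ᵖ⁾`.**
(The admissible `m` are the multiples of the least one `m₀`, by division with remainder in the
subgroup `E⁽ᵖ⁾`, and `ℓ_p` is additive on `E⁽ᵖ⁾`: `ℓ_p(k•m₀•P) = k·ℓ_p(m₀•P)`.)
[cite: SilvermanAEC2009, Thm. IV.6.4(a) with Prop. VII.2.2] [cite: MazurTateTeitelbaum1986, §II] -/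
theorem padicLogPointFiniteExt_eq_div (hp0 : (p : K) ≠ 0) (hp1 : w (p : K) < 1)
    (hℓ : ∀ Q ∈ level w V (w (p : K)), ∀ r : ℕ,
      w (limitLog w V p Q - ((p ^ r) • Q).zCoord / (p : K) ^ r) ≤ w (p : K) ^ (r + 1))
    {P : V.toAffine.Point} {m : ℕ} (hm : 0 < m) (hmP : m • P ∈ level w V (w (p : K))) :
    padicLogPointFiniteExt w V p P = limitLog w V p (m • P) / (m : K) := by
  haveI := charZero_of_val_natCast_lt_one hp0 hp1
  have h : ∃ m : ℕ, 0 < m ∧ m • P ∈ level w V (w (p : K)) := ⟨m, hm, hmP⟩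
  rw [padicLogPointFiniteExt, dif_pos h]
  obtain ⟨hm₀, hm₀P⟩ := Nat.find_spec h
  set m₀ := Nat.find h with hm₀def
  -- `m₀ ∣ m`: otherwise the remainder `m % m₀` would be a smaller admissible multiplier
  have hsplit : m • P = (m % m₀) • P + (m / m₀) • (m₀ • P) := by
    conv_lhs => rw [← Nat.mod_add_div m m₀]
    rw [add_nsmul, mul_nsmul]
  have hdvd : m₀ ∣ m := by
    rw [Nat.dvd_iff_mod_eq_zero]
    by_contra hr
    have hmem : (m % m₀) • P ∈ level w V (w (p : K)) := by
      have e : (m % m₀) • P = m • P - (m / m₀) • (m₀ • P) := by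
        rw [hsplit, add_sub_cancel_right]
      rw [e]
      exact (level w V (w (p : K))).sub_mem hmP ((level w V (w (p : K))).nsmul_mem hm₀P _)
    exact Nat.find_min h (Nat.mod_lt m hm₀) ⟨Nat.pos_of_ne_zero hr, hmem⟩
  obtain ⟨k, hk⟩ := hdvd
  have hk0 : k ≠ 0 := by
    rintro rfl
    rw [mul_zero] at hk
    omega
  have ek : m • P = k • (m₀ • P) := by rw [hk, mul_nsmul]
  rw [ek, limitLog_nsmul hp0 hp1 hℓ hm₀P k, hk, Nat.cast_mul, mul_comm (m₀ : K),
    mul_div_mul_left _ _ (Nat.cast_ne_zero.mpr hk0)]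

/-- On the level itself `log_ω = ℓ_p` (take `m = 1`). [cite: SilvermanAEC2009, Thm. IV.6.4 with Prop. VII.2.2] -/
theorem padicLogPointFiniteExt_eq_limitLog (hp0 : (p : K) ≠ 0) (hp1 : w (p : K) < 1)
    (hℓ : ∀ Q ∈ level w V (w (p : K)), ∀ r : ℕ,
      w (limitLog w V p Q - ((p ^ r) • Q).zCoord / (p : K) ^ r) ≤ w (p : K) ^ (r + 1))
    {P : V.toAffine.Point} (hP : P ∈ level w V (w (p : K))) :
    padicLogPointFiniteExt w V p P = limitLog w V p P := by
  rw [padicLogPointFiniteExt_eq_div hp0 hp1 hℓ Nat.one_pos (by rwa [one_nsmul]), one_nsmul,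
    Nat.cast_one, div_one]

/-- `log_ω(O) = 0`. [cite: SilvermanAEC2009, Thm. IV.6.4(a)] -/
theorem padicLogPointFiniteExt_zero (hp0 : (p : K) ≠ 0) (hp1 : w (p : K) < 1)
    (hℓ : ∀ Q ∈ level w V (w (p : K)), ∀ r : ℕ,
      w (limitLog w V p Q - ((p ^ r) • Q).zCoord / (p : K) ^ r) ≤ w (p : K) ^ (r + 1)) :
    padicLogPointFiniteExt w V p (0 : V.toAffine.Point) = 0 := by
  rw [padicLogPointFiniteExt_eq_limitLog hp0 hp1 hℓ (level w V (w (p : K))).zero_mem,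
    limitLog_zero hp0 hp1 hℓ]

/-- **Additivity: `log_ω(P + Q) = log_ω(P) + log_ω(Q)`** for points with (positive) multiples in
the level — the pattern of the named fact `WeierstrassCurve.padicLogPoint_add` over `ℚ_p`, now over
any complete valued field and on all of `E₀`. [cite: SilvermanAEC2009, Thm. IV.6.4(a) with Prop. VII.2.2] [cite: MazurTateTeitelbaum1986, §II] -/
theorem padicLogPointFiniteExt_add (hp0 : (p : K) ≠ 0) (hp1 : w (p : K) < 1)
    (hℓ : ∀ Q ∈ level w V (w (p : K)), ∀ r : ℕ,
      w (limitLog w V p Q - ((p ^ r) • Q).zCoord / (p : K) ^ r) ≤ w (p : K) ^ (r + 1))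
    {P Q : V.toAffine.Point} {m n : ℕ} (hm : 0 < m) (hmP : m • P ∈ level w V (w (p : K)))
    (hn : 0 < n) (hnQ : n • Q ∈ level w V (w (p : K))) :
    padicLogPointFiniteExt w V p (P + Q) =
      padicLogPointFiniteExt w V p P + padicLogPointFiniteExt w V p Q := by
  haveI := charZero_of_val_natCast_lt_one hp0 hp1
  have eP : (m * n) • P = n • (m • P) := mul_nsmul P m n
  have eQ : (m * n) • Q = m • (n • Q) := by rw [mul_comm]; exact mul_nsmul Q n m
  have hmnP : (m * n) • P ∈ level w V (w (p : K)) := by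
    rw [eP]; exact (level w V (w (p : K))).nsmul_mem hmP n
  have hmnQ : (m * n) • Q ∈ level w V (w (p : K)) := by
    rw [eQ]; exact (level w V (w (p : K))).nsmul_mem hnQ m
  have hmn : (m * n) • (P + Q) ∈ level w V (w (p : K)) := by
    rw [nsmul_add]; exact (level w V (w (p : K))).add_mem hmnP hmnQ
  rw [padicLogPointFiniteExt_eq_div hp0 hp1 hℓ (Nat.mul_pos hm hn) hmn,
    padicLogPointFiniteExt_eq_div hp0 hp1 hℓ hm hmP, padicLogPointFiniteExt_eq_div hp0 hp1 hℓ hn hnQ,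
    nsmul_add, limitLog_add hp0 hp1 hℓ hmnP hmnQ, eP, eQ, limitLog_nsmul hp0 hp1 hℓ hmP n,
    limitLog_nsmul hp0 hp1 hℓ hnQ m, Nat.cast_mul]
  have hm' : (m : K) ≠ 0 := Nat.cast_ne_zero.mpr hm.ne'
  have hn' : (n : K) ≠ 0 := Nat.cast_ne_zero.mpr hn.ne'
  field_simp

/-- `log_ω(−P) = −log_ω(P)`. [cite: SilvermanAEC2009, Thm. IV.6.4(a) with Prop. VII.2.2] -/
theorem padicLogPointFiniteExt_neg (hp0 : (p : K) ≠ 0) (hp1 : w (p : K) < 1)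
    (hℓ : ∀ Q ∈ level w V (w (p : K)), ∀ r : ℕ,
      w (limitLog w V p Q - ((p ^ r) • Q).zCoord / (p : K) ^ r) ≤ w (p : K) ^ (r + 1))
    {P : V.toAffine.Point} {m : ℕ} (hm : 0 < m) (hmP : m • P ∈ level w V (w (p : K))) :
    padicLogPointFiniteExt w V p (-P) = -padicLogPointFiniteExt w V p P := by
  have hmn : m • (-P) ∈ level w V (w (p : K)) := by
    rw [neg_nsmul]; exact (level w V (w (p : K))).neg_mem hmP
  rw [padicLogPointFiniteExt_eq_div hp0 hp1 hℓ hm hmn, padicLogPointFiniteExt_eq_div hp0 hp1 hℓ hm hmP,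
    neg_nsmul, limitLog_neg hp0 hp1 hℓ hmP, neg_div]

/-- `log_ω(n • P) = n · log_ω(P)`. [cite: SilvermanAEC2009, Thm. IV.6.4(a) with Prop. VII.2.2] -/
theorem padicLogPointFiniteExt_nsmul (hp0 : (p : K) ≠ 0) (hp1 : w (p : K) < 1)
    (hℓ : ∀ Q ∈ level w V (w (p : K)), ∀ r : ℕ,
      w (limitLog w V p Q - ((p ^ r) • Q).zCoord / (p : K) ^ r) ≤ w (p : K) ^ (r + 1))
    {P : V.toAffine.Point} {m : ℕ} (hm : 0 < m) (hmP : m • P ∈ level w V (w (p : K))) (n : ℕ) :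
    padicLogPointFiniteExt w V p (n • P) = n * padicLogPointFiniteExt w V p P := by
  have e : m • (n • P) = n • (m • P) := by rw [← mul_nsmul', mul_comm, mul_nsmul']
  have hmn : m • (n • P) ∈ level w V (w (p : K)) := by
    rw [e]; exact (level w V (w (p : K))).nsmul_mem hmP n
  rw [padicLogPointFiniteExt_eq_div hp0 hp1 hℓ hm hmn, e, limitLog_nsmul hp0 hp1 hℓ hmP n,
    padicLogPointFiniteExt_eq_div hp0 hp1 hℓ hm hmP, mul_div_assoc]

/-- **`log_ω(P) = 0` iff `P` is a torsion point**, for a point with a positive multiple in the level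
(`→`: `ℓ_p` has no kernel strictly inside the level, `eq_zero_of_limitLog_eq_zero`, applied to
`p•m•P`; `←`: `ℓ_p` is additive and `K` has characteristic `0`).  The pattern of the tree's
`X11b.R1.logOmega_eq_zero_iff` (`ℚ_p`), now over any complete valued field.
[cite: SilvermanAEC2009, Thm. IV.6.4(b) and Prop. IV.3.2(b) with Prop. VII.2.2] -/
theorem padicLogPointFiniteExt_eq_zero_iff (hp0 : (p : K) ≠ 0) (hp1 : w (p : K) < 1)
    (hℓ : ∀ Q ∈ level w V (w (p : K)), ∀ r : ℕ,
      w (limitLog w V p Q - ((p ^ r) • Q).zCoord / (p : K) ^ r) ≤ w (p : K) ^ (r + 1))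
    {P : V.toAffine.Point} {m : ℕ} (hm : 0 < m) (hmP : m • P ∈ level w V (w (p : K))) :
    padicLogPointFiniteExt w V p P = 0 ↔ IsOfFinAddOrder P := by
  haveI := charZero_of_val_natCast_lt_one hp0 hp1
  have hp : 0 < w (p : K) := (Valuation.pos_iff w).mpr hp0
  have hpn : p ≠ 0 := by rintro rfl; exact hp0 Nat.cast_zero
  rw [padicLogPointFiniteExt_eq_div hp0 hp1 hℓ hm hmP, div_eq_zero_iff,
    or_iff_left (Nat.cast_ne_zero.mpr hm.ne')]
  constructor
  · intro h0
    have hpQ : p • m • P ∈ level w V (w (p : K)) := (level w V (w (p : K))).nsmul_mem hmP p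
    have hlt : w (p • m • P).zCoord < w (p : K) := by
      by_cases hz : (m • P).zCoord = 0
      · rw [(zCoord_eq_zero_iff hmP.1).mp hz, nsmul_zero, WeierstrassCurve.Affine.Point.zCoord_zero,
          map_zero]
        exact hp
      · calc w (p • m • P).zCoord ≤ w (p : K) * w (m • P).zCoord :=
              val_zCoord_natCast_smul_le hmP.1 hmP.2
          _ < w (p : K) * 1 := mul_lt_mul_of_pos_left (val_zCoord_lt_one hmP.1) hp
          _ = w (p : K) := mul_one _
    have h0' : limitLog w V p (p • m • P) = 0 := by
      rw [limitLog_nsmul hp0 hp1 hℓ hmP p, h0, mul_zero]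
    have hzero : (p * m) • P = 0 := by
      rw [mul_nsmul']
      exact eq_zero_of_limitLog_eq_zero hp0 hp1 hℓ hpQ hlt h0'
    exact isOfFinAddOrder_iff_nsmul_eq_zero.mpr ⟨p * m, Nat.mul_pos (Nat.pos_of_ne_zero hpn) hm, hzero⟩
  · intro hfin
    obtain ⟨k, hk, hk0⟩ := isOfFinAddOrder_iff_nsmul_eq_zero.mp hfin
    have e : k • (m • P) = 0 := by rw [← mul_nsmul', mul_comm, mul_nsmul', hk0, nsmul_zero]
    have h := limitLog_nsmul hp0 hp1 hℓ hmP k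
    rw [e, limitLog_zero hp0 hp1 hℓ] at h
    exact (mul_eq_zero.mp h.symm).resolve_left (Nat.cast_ne_zero.mpr hk.ne')

/-- **Integrality on the level**: for `P ∈ E⁽ᵖ⁾`, `|log_ω(P)| ≤ |p|` (`val_limitLog_le_val_natCast`).
[cite: SilvermanAEC2009, Thm. IV.6.4(b)] -/
theorem val_padicLogPointFiniteExt_le_of_mem_level (hp0 : (p : K) ≠ 0) (hp1 : w (p : K) < 1)
    (hℓ : ∀ Q ∈ level w V (w (p : K)), ∀ r : ℕ,
      w (limitLog w V p Q - ((p ^ r) • Q).zCoord / (p : K) ^ r) ≤ w (p : K) ^ (r + 1))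
    {P : V.toAffine.Point} (hP : P ∈ level w V (w (p : K))) :
    w (padicLogPointFiniteExt w V p P) ≤ w (p : K) := by
  rw [padicLogPointFiniteExt_eq_limitLog hp0 hp1 hℓ hP]
  exact val_limitLog_le_val_natCast hp0 hp1 hℓ hP

end Ext

/-! ### Galois equivariance and functoriality in the field -/

section Equivariance

universe u

variable {E : Type u} [Field E] {L : Type u} [Field L] [Algebra E L] {X : WeierstrassCurve E}
  {w : Valuation L ℝ≥0} [hV : (X.baseChange L).IsIntegral w.integer] {p : ℕ}

/-- An isometric `E`-algebra endomorphism preserves the level `E⁽ᵖ⁾` (it preserves `|x| > 1` and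
commutes with `z = -x/y`). [cite: SilvermanAEC2009, Prop. VII.2.2] -/
theorem map_mem_level_of_isometry {σ : L →ₐ[E] L} (hσ : ∀ x, w (σ x) = w x)
    {Q : (X.baseChange L).toAffine.Point} (hQ : Q ∈ level w (X.baseChange L) (w (p : L))) :
    WeierstrassCurve.Affine.Point.map σ Q ∈ level w (X.baseChange L) (w (p : L)) :=
  ⟨(map_mem_kernel_iff hσ Q).mpr hQ.1, by rw [zCoord_map, hσ]; exact hQ.2⟩

/-- **Galois equivariance: `log_ω(σ P) = σ(log_ω P)`** for an isometric `E`-algebra endomorphism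
`σ` of `L ⊇ E` acting on the points of `X ⊗ L` (`X` defined over `E`), and `P` with a positive
multiple in the level (`σ` preserves the level and commutes with `[m]`; `limitLog_map`).
[cite: SilvermanAEC2009, IV.5–IV.6 with Prop. VII.2.2] -/
theorem padicLogPointFiniteExt_map (hp0 : (p : L) ≠ 0) (hp1 : w (p : L) < 1)
    (hℓ : ∀ Q ∈ level w (X.baseChange L) (w (p : L)), ∀ r : ℕ,
      w (limitLog w (X.baseChange L) p Q - ((p ^ r) • Q).zCoord / (p : L) ^ r) ≤ w (p : L) ^ (r + 1))
    {σ : L →ₐ[E] L} (hσ : ∀ x, w (σ x) = w x)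
    {P : (X.baseChange L).toAffine.Point} {m : ℕ} (hm : 0 < m)
    (hmP : m • P ∈ level w (X.baseChange L) (w (p : L))) :
    padicLogPointFiniteExt w (X.baseChange L) p (WeierstrassCurve.Affine.Point.map σ P) =
      σ (padicLogPointFiniteExt w (X.baseChange L) p P) := by
  have hmσ : m • WeierstrassCurve.Affine.Point.map σ P ∈ level w (X.baseChange L) (w (p : L)) := by
    rw [← map_nsmul]; exact map_mem_level_of_isometry hσ hmP
  rw [padicLogPointFiniteExt_eq_div hp0 hp1 hℓ hm hmσ, padicLogPointFiniteExt_eq_div hp0 hp1 hℓ hm hmP,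
    ← map_nsmul, limitLog_map hp1 hℓ hσ hmP, map_div₀, map_natCast]

variable {K K' : Type u} [Field K] [Field K'] [Algebra E K] [Algebra E K']
  {v : Valuation K ℝ≥0} {v' : Valuation K' ℝ≥0}
  [hK : (X.baseChange K).IsIntegral v.integer] [hK' : (X.baseChange K').IsIntegral v'.integer]

/-- **Functoriality in the field: `log_{K'}(ι P) = ι(log_K P)`** along an isometric `E`-algebra map
`ι : K → K'` between valued fields (a finite extension `F ⊆ F'` of `p`-adic fields, an embedding
`F ↪ ℂ_p`, a completion `K ↪ K_v`, …), for `P` with a positive multiple in the level of `X ⊗ K`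
(`limitLog_map_of_val_eq`; both logarithms need (SPEC), i.e. both fields complete).
[cite: SilvermanAEC2009, Thm. IV.6.4 with Prop. VII.2.2] -/
theorem padicLogPointFiniteExt_map_of_val_eq (hp0 : (p : K) ≠ 0) (hp1 : v (p : K) < 1)
    (hℓ : ∀ Q ∈ level v (X.baseChange K) (v (p : K)), ∀ r : ℕ,
      v (limitLog v (X.baseChange K) p Q - ((p ^ r) • Q).zCoord / (p : K) ^ r) ≤ v (p : K) ^ (r + 1))
    (hℓ' : ∀ Q ∈ level v' (X.baseChange K') (v' (p : K')), ∀ r : ℕ,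
      v' (limitLog v' (X.baseChange K') p Q - ((p ^ r) • Q).zCoord / (p : K') ^ r) ≤
        v' (p : K') ^ (r + 1))
    {ι : K →ₐ[E] K'} (hι : ∀ x, v' (ι x) = v x)
    {P : (X.baseChange K).toAffine.Point} {m : ℕ} (hm : 0 < m)
    (hmP : m • P ∈ level v (X.baseChange K) (v (p : K))) :
    padicLogPointFiniteExt v' (X.baseChange K') p (WeierstrassCurve.Affine.Point.map ι P) =
      ι (padicLogPointFiniteExt v (X.baseChange K) p P) := by
  have hp0' : (p : K') ≠ 0 := by rw [← map_natCast ι p]; exact (map_ne_zero ι).mpr hp0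
  have hp1' : v' (p : K') < 1 := by rw [← map_natCast ι p, hι]; exact hp1
  have hmι : m • WeierstrassCurve.Affine.Point.map ι P ∈ level v' (X.baseChange K') (v' (p : K')) := by
    rw [← map_nsmul]; exact map_mem_level_of_val_eq hι hmP
  rw [padicLogPointFiniteExt_eq_div hp0' hp1' hℓ' hm hmι, padicLogPointFiniteExt_eq_div hp0 hp1 hℓ hm hmP,
    ← map_nsmul, limitLog_map_of_val_eq hp1' hℓ hℓ' hι hmP, map_div₀, map_natCast]

end Equivariance

/-! ### Complete nonarchimedean normed fields: the hypothesis-free form -/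

section Normed

variable {K : Type*} [NontriviallyNormedField K] [IsUltrametricDist K] [CompleteSpace K]
  {V : WeierstrassCurve K} [hV : V.IsIntegral (NormedField.valuation (K := K)).integer] {p : ℕ}

/-- **Over a complete nonarchimedean normed field `limitLog` has (SPEC) outright** (`0 < ‖p‖ < 1`):
`‖ℓ_p(Q) − z(pʳ·Q)/pʳ‖ ≤ ‖p‖^{r+1}` for every `Q ∈ E⁽ᵖ⁾` and every `r`.  This is the `hℓ` to feed
to every theorem of the `LimitLog` files and of this file, for `K = ℚ_[p]`, `ℂ_[p]`,
`v.adicCompletion K`, a finite extension of `ℚ_p`, … .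
[cite: SilvermanAEC2009, Thm. IV.6.4 with Prop. VII.2.2] -/
theorem limitLog_spec_of_completeSpace (hp0 : (p : K) ≠ 0)
    (hp1 : NormedField.valuation (p : K) < 1) :
    ∀ Q ∈ level NormedField.valuation V (NormedField.valuation (p : K)), ∀ r : ℕ,
      NormedField.valuation (limitLog NormedField.valuation V p Q - ((p ^ r) • Q).zCoord / (p : K) ^ r)
        ≤ NormedField.valuation (p : K) ^ (r + 1) := by
  obtain ⟨ℓ, hℓ⟩ := exists_limitLog_of_completeSpace (V := V) hp0 hp1
  exact fun Q hQ r ↦ limitLog_spec_of_exists ⟨ℓ Q, hℓ Q hQ⟩ r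

/-- **`ℓ_p(Q)` is the limit of `z(pʳ·Q)/pʳ`** for `Q ∈ E⁽ᵖ⁾` over a complete nonarchimedean normed
field (the name-giving property; error `≤ ‖p‖^{r+1} → 0`).
[cite: SilvermanAEC2009, Thm. IV.6.4 with Prop. VII.2.2] -/
theorem tendsto_limitLog (hp0 : (p : K) ≠ 0) (hp1 : NormedField.valuation (p : K) < 1)
    {Q : V.toAffine.Point} (hQ : Q ∈ level NormedField.valuation V (NormedField.valuation (p : K))) :
    Filter.Tendsto (fun r : ℕ ↦ ((p ^ r) • Q).zCoord / (p : K) ^ r) Filter.atTop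
      (nhds (limitLog NormedField.valuation V p Q)) := by
  have hρ : ‖(p : K)‖ < 1 := by
    rw [NormedField.valuation_apply, ← NNReal.coe_lt_coe, coe_nnnorm, NNReal.coe_one] at hp1
    exact hp1
  rw [tendsto_iff_norm_sub_tendsto_zero]
  refine squeeze_zero (fun _ ↦ norm_nonneg _) (fun r ↦ ?_)
    ((tendsto_pow_atTop_nhds_zero_of_lt_one (norm_nonneg _) hρ).comp (Filter.tendsto_add_atTop_nat 1))
  have h := limitLog_spec_of_completeSpace (V := V) hp0 hp1 Q hQ r
  rw [NormedField.valuation_apply, NormedField.valuation_apply, ← NNReal.coe_le_coe, coe_nnnorm,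
    NNReal.coe_pow, coe_nnnorm] at h
  rw [Function.comp_apply, norm_sub_rev]
  exact h

/-- **Independence of `m`** over a complete nonarchimedean normed field: `log_ω(P) = ℓ_p(m • P)/m`
for every `m ≥ 1` with `m • P ∈ E⁽ᵖ⁾`. [cite: SilvermanAEC2009, Thm. IV.6.4(a) with Prop. VII.2.2] -/
theorem padicLogPointFiniteExt_eq_div_of_completeSpace (hp0 : (p : K) ≠ 0)
    (hp1 : NormedField.valuation (p : K) < 1) {P : V.toAffine.Point} {m : ℕ} (hm : 0 < m)
    (hmP : m • P ∈ level NormedField.valuation V (NormedField.valuation (p : K))) :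
    padicLogPointFiniteExt NormedField.valuation V p P =
      limitLog NormedField.valuation V p (m • P) / (m : K) :=
  padicLogPointFiniteExt_eq_div hp0 hp1 (limitLog_spec_of_completeSpace hp0 hp1) hm hmP

/-- **Additivity** over a complete nonarchimedean normed field, for points with positive multiples
in the level. [cite: SilvermanAEC2009, Thm. IV.6.4(a) with Prop. VII.2.2] -/
theorem padicLogPointFiniteExt_add_of_completeSpace (hp0 : (p : K) ≠ 0)
    (hp1 : NormedField.valuation (p : K) < 1) {P Q : V.toAffine.Point} {m n : ℕ} (hm : 0 < m)
    (hmP : m • P ∈ level NormedField.valuation V (NormedField.valuation (p : K))) (hn : 0 < n)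
    (hnQ : n • Q ∈ level NormedField.valuation V (NormedField.valuation (p : K))) :
    padicLogPointFiniteExt NormedField.valuation V p (P + Q) =
      padicLogPointFiniteExt NormedField.valuation V p P +
        padicLogPointFiniteExt NormedField.valuation V p Q :=
  padicLogPointFiniteExt_add hp0 hp1 (limitLog_spec_of_completeSpace hp0 hp1) hm hmP hn hnQ

/-- **`log_ω(P) = 0 ↔ P` torsion** over a complete nonarchimedean normed field, for a point with a
positive multiple in the level. [cite: SilvermanAEC2009, Thm. IV.6.4(b) with Prop. VII.2.2] -/
theorem padicLogPointFiniteExt_eq_zero_iff_of_completeSpace (hp0 : (p : K) ≠ 0)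
    (hp1 : NormedField.valuation (p : K) < 1) {P : V.toAffine.Point} {m : ℕ} (hm : 0 < m)
    (hmP : m • P ∈ level NormedField.valuation V (NormedField.valuation (p : K))) :
    padicLogPointFiniteExt NormedField.valuation V p P = 0 ↔ IsOfFinAddOrder P :=
  padicLogPointFiniteExt_eq_zero_iff hp0 hp1 (limitLog_spec_of_completeSpace hp0 hp1) hm hmP

end Normed

/-! ### The `ℂ_p`-valued logarithm: the instance `K := ℂ_[p]`

Over `ℂ_p` (Mathlib `PadicComplex`, complete, ultrametric, algebraically closed) the two standing
hypotheses are `(p : ℂ_[p]) ≠ 0` (`Nat.cast_ne_zero`, characteristic `0`) and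
`NormedField.valuation (p : ℂ_[p]) < 1` (`‖p‖ = p⁻¹`: `PadicComplex.norm_extends'` + `Padic.norm_p`);
the corollaries below discharge them.  A point over a finite extension `F` read in `ℂ_p` along an
isometric embedding `ι : F →ₐ[ℚ] ℂ_[p]` has `log_{ℂ_p}(ι P) = ι(log_F P)`
(`padicLogPointFiniteExt_map_of_val_eq`). -/

section PadicComplex

variable {p : ℕ} [Fact p.Prime]

/-- `p ≠ 0` in `ℂ_p`. [folklore] -/
private theorem natCast_ne_zero_padicComplex : ((p : ℂ_[p]) ≠ 0) :=
  Nat.cast_ne_zero.mpr (Fact.out : p.Prime).ne_zero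

/-- `‖p‖ < 1` in `ℂ_p` (`‖p‖ = p⁻¹`), in the valuation language of the chart files. [folklore] -/
private theorem valuation_natCast_lt_one_padicComplex :
    NormedField.valuation (p : ℂ_[p]) < 1 := by
  rw [NormedField.valuation_apply, ← NNReal.coe_lt_coe, coe_nnnorm, NNReal.coe_one,
    ← map_natCast (algebraMap ℚ_[p] ℂ_[p]) p]
  change ‖((p : ℚ_[p]) : ℂ_[p])‖ < 1
  rw [PadicComplex.norm_extends', Padic.norm_p]
  exact inv_lt_one_of_one_lt₀ (by exact_mod_cast (Fact.out : p.Prime).one_lt)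

variable {X : WeierstrassCurve ℂ_[p]} [hV : X.IsIntegral (NormedField.valuation (K := ℂ_[p])).integer]

/-- **Over `ℂ_p` the limit logarithm has (SPEC) on `E⁽ᵖ⁾(ℂ_p) = {P ∈ E₁(ℂ_p) : |z(P)| ≤ p⁻¹}`**
with no further hypothesis — the `hℓ` for every theorem of the `LimitLog` files over `ℂ_p`.
[cite: SilvermanAEC2009, Thm. IV.6.4 with Prop. VII.2.2] -/
theorem limitLog_spec_padicComplex :
    ∀ Q ∈ level NormedField.valuation X (NormedField.valuation (p : ℂ_[p])), ∀ r : ℕ,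
      NormedField.valuation (limitLog NormedField.valuation X p Q - ((p ^ r) • Q).zCoord / (p : ℂ_[p]) ^ r)
        ≤ NormedField.valuation (p : ℂ_[p]) ^ (r + 1) :=
  limitLog_spec_of_completeSpace natCast_ne_zero_padicComplex valuation_natCast_lt_one_padicComplex

/-- **Independence of `m` over `ℂ_p`**: `log_ω(P) = ℓ_p(m • P)/m` for every `m ≥ 1` with
`m • P ∈ E⁽ᵖ⁾(ℂ_p)`. [cite: SilvermanAEC2009, Thm. IV.6.4(a) with Prop. VII.2.2] -/
theorem padicLogPointFiniteExt_eq_div_padicComplex {P : X.toAffine.Point} {m : ℕ} (hm : 0 < m)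
    (hmP : m • P ∈ level NormedField.valuation X (NormedField.valuation (p : ℂ_[p]))) :
    padicLogPointFiniteExt NormedField.valuation X p P =
      limitLog NormedField.valuation X p (m • P) / (m : ℂ_[p]) :=
  padicLogPointFiniteExt_eq_div_of_completeSpace natCast_ne_zero_padicComplex
    valuation_natCast_lt_one_padicComplex hm hmP

/-- **Additivity over `ℂ_p`** for points with positive multiples in the level.
[cite: SilvermanAEC2009, Thm. IV.6.4(a) with Prop. VII.2.2] -/
theorem padicLogPointFiniteExt_add_padicComplex {P Q : X.toAffine.Point} {m n : ℕ} (hm : 0 < m)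
    (hmP : m • P ∈ level NormedField.valuation X (NormedField.valuation (p : ℂ_[p]))) (hn : 0 < n)
    (hnQ : n • Q ∈ level NormedField.valuation X (NormedField.valuation (p : ℂ_[p]))) :
    padicLogPointFiniteExt NormedField.valuation X p (P + Q) =
      padicLogPointFiniteExt NormedField.valuation X p P +
        padicLogPointFiniteExt NormedField.valuation X p Q :=
  padicLogPointFiniteExt_add_of_completeSpace natCast_ne_zero_padicComplex
    valuation_natCast_lt_one_padicComplex hm hmP hn hnQ

/-- **`log_ω(P) = 0 ↔ P` torsion over `ℂ_p`**, for a point with a positive multiple in the level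
(every point of `E₁(ℂ_p)` has one, `exists_nsmul_mem_level_padicComplex`).
[cite: SilvermanAEC2009, Thm. IV.6.4(b) with Prop. VII.2.2] -/
theorem padicLogPointFiniteExt_eq_zero_iff_padicComplex {P : X.toAffine.Point} {m : ℕ} (hm : 0 < m)
    (hmP : m • P ∈ level NormedField.valuation X (NormedField.valuation (p : ℂ_[p]))) :
    padicLogPointFiniteExt NormedField.valuation X p P = 0 ↔ IsOfFinAddOrder P :=
  padicLogPointFiniteExt_eq_zero_iff_of_completeSpace natCast_ne_zero_padicComplex
    valuation_natCast_lt_one_padicComplex hm hmP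

/-- **Every point of `E₁(ℂ_p)` has a positive multiple in the level** (`ℂ_p` is infinitely
ramified, so `E⁽ᵖ⁾ ≠ E₁`, but `p`-power multiples still enter the level).
[cite: SilvermanAEC2009, Prop. IV.3.2 with Prop. VII.2.2] -/
theorem exists_nsmul_mem_level_padicComplex {P : X.toAffine.Point}
    (hP : P ∈ kernel NormedField.valuation X) :
    ∃ m : ℕ, 0 < m ∧ m • P ∈ level NormedField.valuation X (NormedField.valuation (p : ℂ_[p])) :=
  exists_nsmul_mem_level_of_mem_kernel natCast_ne_zero_padicComplex hP

end PadicComplex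

/-! ### The `ℚ_p` case: agreement with the tree's `padicLimitLog` (hence `padicLogPoint`, `logOmega`) -/

section Padic

variable {p : ℕ} [Fact p.Prime] {X : WeierstrassCurve ℚ_[p]} [X.IsIntegral ℤ_[p]] [X.IsElliptic]
  [hV : X.IsIntegral (NormedField.valuation (K := ℚ_[p])).integer]

/-- `0 < ‖p‖ < 1` in `ℚ_p`, in the valuation language. [folklore] -/
private theorem natCast_ne_zero_and_valuation_lt_one_padic :
    ((p : ℚ_[p]) ≠ 0) ∧ NormedField.valuation (p : ℚ_[p]) < 1 := by
  refine ⟨Nat.cast_ne_zero.mpr (Fact.out : p.Prime).ne_zero, ?_⟩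
  rw [NormedField.valuation_apply, ← NNReal.coe_lt_coe, coe_nnnorm, NNReal.coe_one, Padic.norm_p]
  exact inv_lt_one_of_one_lt₀ (by exact_mod_cast (Fact.out : p.Prime).one_lt)

/-- **Agreement over `ℚ_p`**: for a `p`-integral elliptic `X/ℚ_p` and a point `P` with
`m • P ∈ E₁(ℚ_p)` (`m ≥ 1`; over `ℚ_p` the level `E⁽ᵖ⁾` is all of `E₁`, `level_padic_eq_kernel`),
`log_ω(P) = padicLimitLog(p • m • P) / (p · m)` with the tree's limit logarithm
`WeierstrassCurve.padicLimitLog` (`limitLog_eq_padicLimitLog_smul_div`).  On the Summits side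
`Additive.LocalLog.padicLog X P = padicLimitLog(N • P)/N = log_W(z(N • P))/N` and
`X11b.Halves.logOmega = padicLog (W ⊗ ℚ_p) P_ι`, so this is the `K = ℚ_p` case of the request's
"agreement with `padicLogPoint` / `logOmega`". [cite: SilvermanAEC2009, Thm. IV.6.4 and Prop. VII.6.3] -/
theorem padicLogPointFiniteExt_eq_padicLimitLog_div {P : X.toAffine.Point} {m : ℕ} (hm : 0 < m)
    (hmP : m • P ∈ kernel NormedField.valuation X) :
    padicLogPointFiniteExt NormedField.valuation X p P =
      X.padicLimitLog (p • m • P) / ((p : ℚ_[p]) * (m : ℚ_[p])) := by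
  obtain ⟨hp0, hp1⟩ := natCast_ne_zero_and_valuation_lt_one_padic (p := p)
  have hℓ := limitLog_spec_of_completeSpace (V := X) hp0 hp1
  have hℓK : ∀ Q ∈ kernel NormedField.valuation X, ∀ r : ℕ,
      NormedField.valuation (limitLog NormedField.valuation X p Q - ((p ^ r) • Q).zCoord / (p : ℚ_[p]) ^ r)
        ≤ NormedField.valuation (p : ℚ_[p]) ^ (r + 1) := fun Q hQ ↦ hℓ Q (by
    rw [level_padic_eq_kernel]; exact hQ)
  have hmP' : m • P ∈ level NormedField.valuation X (NormedField.valuation (p : ℚ_[p])) := by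
    rw [level_padic_eq_kernel]; exact hmP
  rw [padicLogPointFiniteExt_eq_div hp0 hp1 hℓ hm hmP', limitLog_eq_padicLimitLog_smul_div hℓK hmP,
    div_div]

/-- In particular on `E₁(ℚ_p)` itself: `log_ω(P) = padicLimitLog(p • P)/p`.
[cite: SilvermanAEC2009, Thm. IV.6.4 and Prop. VII.6.3] -/
theorem padicLogPointFiniteExt_eq_padicLimitLog_div_of_mem_kernel {P : X.toAffine.Point}
    (hP : P ∈ kernel NormedField.valuation X) :
    padicLogPointFiniteExt NormedField.valuation X p P = X.padicLimitLog (p • P) / (p : ℚ_[p]) := by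
  rw [padicLogPointFiniteExt_eq_padicLimitLog_div Nat.one_pos (by rwa [one_nsmul]), one_nsmul,
    Nat.cast_one, mul_one]

end Padic

end Literature.NumberTheory.EllipticCurves.FormalGroupChart

end
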